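import Literature.AlgebraicGeometry.Limits.SliceBaseChange
import Literature.AlgebraicGeometry.Limits.GrpTransfer
import Literature.AlgebraicGeometry.Limits.SeparatedSchematicExt
import Literature.AlgebraicGeometry.Limits.SubalgebraEndomorphismRingSpread   -- ★ `LiftedGrpData.isCommMonObj_of`
import Mathlib.AlgebraicGeometry.Morphisms.Flat
import HarnessLib

/-!
# Transfer of a group law along a factorisation `G → T → X` of schemes over a base (EGA IV₃ 8.8.2, fixed stage, RELATIVE base)

Topic `Literature/AlgebraicGeometry/Limits`; namespace `Literature.AlgebraicGeometry.Limits.OverFac`.  DEFINITIONS with bodies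
(`facObjIso`, `facIso`, `mulExt`, `oneExt`, `invExt`, the structure `GrpSpreadAlong` and its `restrict ∕ mul ∕ one ∕ inv ∕ liftedGrpData ∕ grpObj`)
+ THEOREMS; no instance, no notation, no named fact, no `sorry`.  Cell `hodgecm-mathlib` (D-0151), FLOOR 0, P6 «MOD programme»
(crux hLiu418 = stmt-HodgeConjecture-24832, `--supports`, count-neutral), SPREAD door (LEAD F0P6-plan M-17m), organ (α) SP1 (d) «RELATIVE GROUP-LAW
SPREAD» (A-p06 (g31) census `CENSUS-SP1-AbelianSchemeSpreadStage` §3 (d); LEAD 20:42:56Z), FILE 1 of 2: the ABSTRACT fixed-stage transfer.  FILE 2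
(`Limits/LocalizationRelativeGroupSpread`) instantiates it at the localisation tower `P ⊗ Spec A_S → P ⊗ D(s) → P ⊗ D(t)` of ★ `Limits/LocalizationProdLimit`.
HC_CM is proved only modulo the printed citations (2 remaining named inputs hLiu418, h413) until rung 0 closes; nothing here is about HC.

SETTING.  `X` a scheme, `T G : Over X` and a morphism `ℓ : G ⟶ T` over `X` (think: `X = P ⊗ D(t)` a stage of the base, `T = P ⊗ D(s)` a finer stage,
`G = P ⊗ Spec A_S` the generic base), `Y : Over X` an `X`-scheme whose base change `Y_G = Y ×_X G` carries a group-scheme structure over `G`.  This is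
★ `Limits/LocalizationGroupSpread` (the ABSOLUTE case `X = Spec A`, `T = Spec A[1∕s]`, `G = Spec A_S`) with the base ring replaced by an arbitrary base
scheme `X`: every construction there is a construction in the cartesian monoidal category `Over X` and transcribes token for token.

* §1 `facObjIso ℓ Q : (Q ×_X T) ×_T G ≅ Q ×_X G` (★ `SliceBaseChange.pullbackFacObjIso` for `ℓ ≫ T.hom = G.hom`) and its monoidality in explicit form
  (`map_μ_comp_facObjIso_hom`, `map_ε_comp_facObjIso_hom`; a natural transformation of cartesian functors is monoidal).
* §2 the structure maps of `Y_G` as `X`-morphisms `mulExt : (Y ⊗ Y) ⊗ G ⟶ Y`, `oneExt : 𝟙 ⊗ G ⟶ Y`, `invExt : Y ⊗ G ⟶ Y` (★ `unsliceHom`), and the datum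
  `GrpSpreadAlong ℓ Y` of their SPREADINGS to `T`: `gm : (Y ⊗ Y) ⊗ T ⟶ Y`, `ge`, `gi` restricting along `ℓ` to `mulExt ∕ oneExt ∕ invExt`; `restrict` to a
  finer stage `T' → T` under `G`.
* §3 FIXED-STAGE TRANSFER: the candidate structure maps `mul ∕ one ∕ inv` on `Y_T = Y ×_X T` (★ `sliceHom`), their base changes along `ℓ` ARE the structure
  maps of `(Y_T)_G ≅ Y_G` (`map_mul ∕ map_one ∕ map_inv`, through ★ `pullback_map_sliceHom`); and **if `ℓ.left` is quasi-compact and scheme-theoretically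
  dominant, `Y_T → T` flat and separated**, base change along `ℓ` is injective on `T`-morphisms from flat `T`-schemes to `Y_T` (★
  `SeparatedSchematicExt.pullback_map_injective_of_flat`), so the lifts form a group-scheme structure on `Y_T` over `T` (★ `GrpTransfer.LiftedGrpData.grpObj`):
  **`GrpSpreadAlong.grpObj`**, with `(Y_T)_G ≅ Y_G` an isomorphism of group schemes (**`isMonHom_facObjIso_hom`**) and commutativity inherited
  (**`isCommMonObj`**, ★ `LiftedGrpData.isCommMonObj_of`).

THE PRINT.  [EGAIV3] Thm. 8.8.2: for `S = lim Sᵢ` (affine transitions, `S₀`-schemes quasi-compact quasi-separated, of finite presentation) the category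
of finitely presented `S`-schemes is the colimit of the categories over the `Sᵢ` — applied to the finite diagrams expressing a group structure
([StacksProject] Tags 01ZM, 01ZC); [GortzWedhorn2020] Thm. 10.57 ∕ Cor. 10.64 (spreading out of morphisms), Prop. 9.19 ∕ Rem. 9.20 (morphisms to a
separated scheme agreeing on a schematically dense subscheme are equal).  Here only the UNIQUENESS at a FIXED stage is used (flat sources, separated target),
exactly as in ★ `LocalizationGroupSpread`; the existence of spreadings is the input `GrpSpreadAlong` (FILE 2 produces it from relative 8.8.2 (i)).

## References
* [EGAIV3] A. Grothendieck, J. Dieudonné, *EGA IV₃*, Publ. Math. IHÉS 28 (1966), Thm. 8.8.2, 11.10.1, 11.10.5.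
* [StacksProject] The Stacks Project, Tags 01ZC, 01ZM.
* [GortzWedhorn2020] U. Görtz, T. Wedhorn, *Algebraic Geometry I*, 2nd ed. (2020), §(4.7) (4.7.1), Prop. 4.16, Prop. 9.19, Rem. 9.20, Thm. 10.57, Cor. 10.64.
* [Milne1986AbelianVarieties] J. S. Milne, *Abelian Varieties*, in Cornell–Silverman (1986), §20 Rem. 20.9 (p. 146).
-/

set_option autoImplicit false

noncomputable section

universe u

open CategoryTheory CategoryTheory.Limits AlgebraicGeometry MonoidalCategory CartesianMonoidalCategory MonObj
open Functor.LaxMonoidal Functor.OplaxMonoidal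
open scoped CategoryTheory.Obj

namespace Literature.AlgebraicGeometry.Limits

namespace OverFac

set_option backward.isDefEq.respectTransparency false

variable {X : Scheme.{u}} {T G : Over X} (ℓ : G ⟶ T)

/-! ## §1 The factorisation isomorphism `(Q ×_X T) ×_T G ≅ Q ×_X G` and its monoidality -/

/-- `(Q_T)_G ≅ Q_G`: base change to `G` of the base change to `T` is the base change to `G` (★ `SliceBaseChange.pullbackFacObjIso` for the
factorisation `ℓ ≫ T.hom = G.hom`). [cite: GortzWedhorn2020, §(4.7) Prop. 4.16] -/
abbrev facObjIso (Q : Over X) :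
    (Over.pullback ℓ.left).obj ((Over.pullback T.hom).obj Q) ≅ (Over.pullback G.hom).obj Q :=
  pullbackFacObjIso T.hom ℓ.left G.hom (Over.w ℓ) Q

/-- The same as a natural isomorphism `Over.pullback T.hom ⋙ Over.pullback ℓ.left ≅ Over.pullback G.hom` (monoidal: a natural transformation of
cartesian functors). [cite: GortzWedhorn2020, §(4.7) Prop. 4.16] -/
abbrev facIso : Over.pullback T.hom ⋙ Over.pullback ℓ.left ≅ Over.pullback G.hom :=
  pullbackFacIso T.hom ℓ.left G.hom (Over.w ℓ)

/-- Tensor compatibility of `(–)_T|_G ≅ (–)_G` (Mathlib `NatTrans.IsMonoidal.of_cartesianMonoidalCategory`), solved for the base change of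
`μ : Q_T ⊗ R_T ≅ (Q ⊗ R)_T`. [cite: GortzWedhorn2020, §(4.7) Prop. 4.16] -/
@[reassoc]
theorem map_μ_comp_facObjIso_hom (Q R : Over X) :
    (Over.pullback ℓ.left).map (Functor.LaxMonoidal.μ (Over.pullback T.hom) Q R) ≫ (facObjIso ℓ (Q ⊗ R)).hom =
      Functor.OplaxMonoidal.δ (Over.pullback ℓ.left) ((Over.pullback T.hom).obj Q) ((Over.pullback T.hom).obj R) ≫
        ((facObjIso ℓ Q).hom ⊗ₘ (facObjIso ℓ R).hom) ≫ Functor.LaxMonoidal.μ (Over.pullback G.hom) Q R := by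
  have e := NatTrans.IsMonoidal.tensor (τ := (facIso ℓ).hom) Q R
  rw [Functor.LaxMonoidal.comp_μ, Category.assoc] at e
  rw [← cancel_epi (Functor.LaxMonoidal.μ (Over.pullback ℓ.left) ((Over.pullback T.hom).obj Q) ((Over.pullback T.hom).obj R)),
    Functor.Monoidal.μ_δ_assoc]
  exact e

/-- Unit compatibility of `(–)_T|_G ≅ (–)_G`, solved for the base change of `ε : 𝟙 ≅ 𝟙_T`. [cite: GortzWedhorn2020, §(4.7) Prop. 4.16] -/
@[reassoc]
theorem map_ε_comp_facObjIso_hom :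
    (Over.pullback ℓ.left).map (Functor.LaxMonoidal.ε (Over.pullback T.hom)) ≫ (facObjIso ℓ (𝟙_ (Over X))).hom =
      Functor.OplaxMonoidal.η (Over.pullback ℓ.left) ≫ Functor.LaxMonoidal.ε (Over.pullback G.hom) := by
  have e := NatTrans.IsMonoidal.unit (τ := (facIso ℓ).hom)
  rw [Functor.LaxMonoidal.comp_ε, Category.assoc] at e
  rw [← cancel_epi (Functor.LaxMonoidal.ε (Over.pullback ℓ.left)), Functor.Monoidal.ε_η_assoc]
  exact e

/-! ## §2 The structure maps of `Y_G` as `X`-morphisms, and the datum of their spreadings to `T` -/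

section Ext

variable (G) (Y : Over X) [GrpObj ((Over.pullback G.hom).obj Y)]

/-- The multiplication of `Y_G`, as an `X`-morphism `(Y ⊗ Y) ⊗ G ⟶ Y`. [cite: GortzWedhorn2020, §(4.7) (4.7.1)] -/
def mulExt : (Y ⊗ Y) ⊗ G ⟶ Y :=
  unsliceHom G (Functor.OplaxMonoidal.δ (Over.pullback G.hom) Y Y ≫ μ[(Over.pullback G.hom).obj Y])

/-- The unit of `Y_G`, as an `X`-morphism `𝟙 ⊗ G ⟶ Y`. [cite: GortzWedhorn2020, §(4.7) (4.7.1)] -/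
def oneExt : 𝟙_ (Over X) ⊗ G ⟶ Y :=
  unsliceHom G (Functor.OplaxMonoidal.η (Over.pullback G.hom) ≫ η[(Over.pullback G.hom).obj Y])

/-- The inverse of `Y_G`, as an `X`-morphism `Y ⊗ G ⟶ Y`. [cite: GortzWedhorn2020, §(4.7) (4.7.1)] -/
def invExt : Y ⊗ G ⟶ Y :=
  unsliceHom G ι[(Over.pullback G.hom).obj Y]

variable {G}

/-- `GrpSpreadAlong ℓ Y`: SPREADINGS to `T` of the multiplication, unit and inverse of `Y_G` — `X`-morphisms out of `(Y ⊗ Y) ⊗ T`, `𝟙 ⊗ T`, `Y ⊗ T`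
restricting along `ℓ : G ⟶ T` to `mulExt`, `oneExt`, `invExt` (the existence half of EGA IV₃ 8.8.2 (i) supplies such data at some stage).
[cite: EGAIV3, Thm. 8.8.2 (i)] -/
structure GrpSpreadAlong where
  /-- spreading of the multiplication -/
  gm : (Y ⊗ Y) ⊗ T ⟶ Y
  /-- spreading of the unit -/
  ge : 𝟙_ (Over X) ⊗ T ⟶ Y
  /-- spreading of the inverse -/
  gi : Y ⊗ T ⟶ Y
  /-- `gm` restricts to the multiplication -/
  hm : ((Y ⊗ Y) ◁ ℓ) ≫ gm = mulExt G Y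
  /-- `ge` restricts to the unit -/
  he : (𝟙_ (Over X) ◁ ℓ) ≫ ge = oneExt G Y
  /-- `gi` restricts to the inverse -/
  hi : (Y ◁ ℓ) ≫ gi = invExt G Y

variable {ℓ Y}

/-- Spreadings restrict to a finer stage `T'` under `G` (`ℓ' ≫ m = ℓ`). [cite: EGAIV3, Thm. 8.8.2 (i)] -/
def GrpSpreadAlong.restrict (d : GrpSpreadAlong ℓ Y) {T' : Over X} (m : T' ⟶ T) (ℓ' : G ⟶ T') (hℓ : ℓ' ≫ m = ℓ) :
    GrpSpreadAlong ℓ' Y where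
  gm := ((Y ⊗ Y) ◁ m) ≫ d.gm
  ge := (𝟙_ (Over X) ◁ m) ≫ d.ge
  gi := (Y ◁ m) ≫ d.gi
  hm := by rw [← MonoidalCategory.whiskerLeft_comp_assoc, hℓ, d.hm]
  he := by rw [← MonoidalCategory.whiskerLeft_comp_assoc, hℓ, d.he]
  hi := by rw [← MonoidalCategory.whiskerLeft_comp_assoc, hℓ, d.hi]

end Ext

/-! ## §3 The group structure on `Y_T` when `ℓ` is schematically dominant, `Y_T → T` flat and separated -/

section Transfer

variable {ℓ} {Y : Over X} [GrpObj ((Over.pullback G.hom).obj Y)]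

/-- The group structure on `(Y_T)_G` transported from `Y_G` along `(Y_T)_G ≅ Y_G`. [cite: GortzWedhorn2020, §(4.7) Prop. 4.16] -/
abbrev grpObjLegObj (ℓ : G ⟶ T) (Y : Over X) [GrpObj ((Over.pullback G.hom).obj Y)] :
    GrpObj ((Over.pullback ℓ.left).obj ((Over.pullback T.hom).obj Y)) :=
  GrpObj.ofIso (facObjIso ℓ Y).symm

attribute [local instance] grpObjLegObj

/-- The candidate multiplication on `Y_T`: `Y_T ⊗ Y_T ≅ (Y ⊗ Y)_T → Y_T`, the second map being the `T`-morphism attached to `gm`.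
[cite: GortzWedhorn2020, §(4.7) (4.7.1)] -/
def GrpSpreadAlong.mul (d : GrpSpreadAlong ℓ Y) :
    (Over.pullback T.hom).obj Y ⊗ (Over.pullback T.hom).obj Y ⟶ (Over.pullback T.hom).obj Y :=
  Functor.LaxMonoidal.μ (Over.pullback T.hom) Y Y ≫ sliceHom T d.gm

/-- The candidate unit on `Y_T`: `𝟙 ≅ 𝟙_T → Y_T`. [cite: GortzWedhorn2020, §(4.7) (4.7.1)] -/
def GrpSpreadAlong.one (d : GrpSpreadAlong ℓ Y) : 𝟙_ (Over T.left) ⟶ (Over.pullback T.hom).obj Y :=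
  Functor.LaxMonoidal.ε (Over.pullback T.hom) ≫ sliceHom T d.ge

/-- The candidate inverse on `Y_T`. [cite: GortzWedhorn2020, §(4.7) (4.7.1)] -/
def GrpSpreadAlong.inv (d : GrpSpreadAlong ℓ Y) : (Over.pullback T.hom).obj Y ⟶ (Over.pullback T.hom).obj Y :=
  sliceHom T d.gi

/-- Base change along `ℓ` of the `T`-morphism attached to `gm`: the multiplication of `Y_G`, conjugated by `((Y ⊗ Y)_T)_G ≅ (Y ⊗ Y)_G`,
`(Y_T)_G ≅ Y_G` (★ `pullback_map_sliceHom`, `hm`). [cite: GortzWedhorn2020, §(4.7) (4.7.1) and Prop. 4.16] -/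
theorem GrpSpreadAlong.map_sliceHom_gm (d : GrpSpreadAlong ℓ Y) :
    (Over.pullback ℓ.left).map (sliceHom T d.gm) =
      (facObjIso ℓ (Y ⊗ Y)).hom ≫ Functor.OplaxMonoidal.δ (Over.pullback G.hom) Y Y ≫ μ[(Over.pullback G.hom).obj Y] ≫
        (facObjIso ℓ Y).inv := by
  have e := pullback_map_sliceHom ℓ (P := Y) d.gm
  rw [d.hm, mulExt, sliceHom_unsliceHom] at e
  simpa only [Category.assoc] using (Iso.eq_comp_inv _).mpr e

/-- Base change along `ℓ` of the `T`-morphism attached to `ge`: the unit of `Y_G`. [cite: GortzWedhorn2020, §(4.7) (4.7.1) and Prop. 4.16] -/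
theorem GrpSpreadAlong.map_sliceHom_ge (d : GrpSpreadAlong ℓ Y) :
    (Over.pullback ℓ.left).map (sliceHom T d.ge) =
      (facObjIso ℓ (𝟙_ (Over X))).hom ≫ Functor.OplaxMonoidal.η (Over.pullback G.hom) ≫ η[(Over.pullback G.hom).obj Y] ≫
        (facObjIso ℓ Y).inv := by
  have e := pullback_map_sliceHom ℓ (P := Y) d.ge
  rw [d.he, oneExt, sliceHom_unsliceHom] at e
  simpa only [Category.assoc] using (Iso.eq_comp_inv _).mpr e

/-- Base change along `ℓ` of the `T`-morphism attached to `gi`: the inverse of `Y_G`. [cite: GortzWedhorn2020, §(4.7) (4.7.1) and Prop. 4.16] -/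
theorem GrpSpreadAlong.map_sliceHom_gi (d : GrpSpreadAlong ℓ Y) :
    (Over.pullback ℓ.left).map (sliceHom T d.gi) = (facObjIso ℓ Y).hom ≫ ι[(Over.pullback G.hom).obj Y] ≫ (facObjIso ℓ Y).inv := by
  have e := pullback_map_sliceHom ℓ (P := Y) d.gi
  rw [d.hi, invExt, sliceHom_unsliceHom] at e
  simpa only [Category.assoc] using (Iso.eq_comp_inv _).mpr e

/-- Restricted along `ℓ`, the candidate multiplication is the multiplication of `(Y_T)_G` (transported from `Y_G`): the dictionary commutes with
base change, `gm` restricts to `mulExt`, and `(Y_T)_G ≅ Y_G` is monoidal. [cite: EGAIV3, Thm. 8.8.2 (i)] -/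
theorem GrpSpreadAlong.map_mul (d : GrpSpreadAlong ℓ Y) :
    (Over.pullback ℓ.left).map d.mul =
      Functor.OplaxMonoidal.δ (Over.pullback ℓ.left) ((Over.pullback T.hom).obj Y) ((Over.pullback T.hom).obj Y) ≫
        μ[(Over.pullback ℓ.left).obj ((Over.pullback T.hom).obj Y)] := by
  rw [GrpSpreadAlong.mul, Functor.map_comp, d.map_sliceHom_gm, map_μ_comp_facObjIso_hom_assoc, Functor.Monoidal.μ_δ_assoc,
    MonObj.ofIso_mul]
  simp only [Iso.symm_inv, Iso.symm_hom]

/-- Restricted along `ℓ`, the candidate unit is the unit of `(Y_T)_G`. [cite: EGAIV3, Thm. 8.8.2 (i)] -/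
theorem GrpSpreadAlong.map_one (d : GrpSpreadAlong ℓ Y) :
    (Over.pullback ℓ.left).map d.one =
      Functor.OplaxMonoidal.η (Over.pullback ℓ.left) ≫ η[(Over.pullback ℓ.left).obj ((Over.pullback T.hom).obj Y)] := by
  rw [GrpSpreadAlong.one, Functor.map_comp, d.map_sliceHom_ge, map_ε_comp_facObjIso_hom_assoc, Functor.Monoidal.ε_η_assoc,
    MonObj.ofIso_one]
  simp only [Iso.symm_hom]

/-- Restricted along `ℓ`, the candidate inverse is the inverse of `(Y_T)_G`. [cite: EGAIV3, Thm. 8.8.2 (i)] -/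
theorem GrpSpreadAlong.map_inv (d : GrpSpreadAlong ℓ Y) :
    (Over.pullback ℓ.left).map d.inv = ι[(Over.pullback ℓ.left).obj ((Over.pullback T.hom).obj Y)] := by
  rw [GrpSpreadAlong.inv, d.map_sliceHom_gi, GrpObj.ofIso_inv]
  simp only [Iso.symm_inv, Iso.symm_hom]

variable [QuasiCompact ℓ.left] [IsSchemeTheoreticallyDominant ℓ.left]
  [Flat ((Over.pullback T.hom).obj Y).hom] [IsSeparated ((Over.pullback T.hom).obj Y).hom]

/-- **The lifted group data on `Y_T`.**  With `ℓ.left` quasi-compact and scheme-theoretically dominant and `Y_T → T` flat and separated,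
base change along `ℓ` is injective on `T`-morphisms `Z → Y_T` from flat `T`-schemes `Z` (★ `pullback_map_injective_of_flat`), and the candidate
structure maps lift those of `(Y_T)_G`. [cite: EGAIV3, Thm. 8.8.2] [cite: GortzWedhorn2020, Prop. 9.19 and Rem. 9.20] -/
def GrpSpreadAlong.liftedGrpData (d : GrpSpreadAlong ℓ Y) :
    LiftedGrpData (Over.pullback ℓ.left) ((Over.pullback T.hom).obj Y) (fun Z => Flat Z.hom) where
  injective Z hZ := by
    haveI : Flat Z.hom := hZ
    exact pullback_map_injective_of_flat ℓ.left
  tensor Z W hZ hW := by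
    haveI : Flat Z.hom := hZ
    haveI : Flat W.hom := hW
    exact inferInstanceAs (Flat (pullback.fst Z.hom W.hom ≫ Z.hom))
  unit := inferInstanceAs (Flat (𝟙 _))
  self := ‹_›
  one := d.one
  mul := d.mul
  inv := d.inv
  map_one := d.map_one
  map_mul := d.map_mul
  map_inv := d.map_inv

/-- **The group-scheme structure on `Y_T = Y ×_X T` over `T`** descended from the group structure on `Y_G` (EGA IV₃ 8.8.2 for the diagrams of a
group object, at a fixed stage): unit, multiplication and inverse are the spread-out structure maps, and the axioms hold because they hold after the
injective base change along `ℓ`. [cite: EGAIV3, Thm. 8.8.2] [cite: StacksProject, Tag 01ZM] -/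
abbrev GrpSpreadAlong.grpObj (d : GrpSpreadAlong ℓ Y) : GrpObj ((Over.pullback T.hom).obj Y) :=
  d.liftedGrpData.grpObj

/-- **`(Y_T)_G ≅ Y_G` is an isomorphism of group schemes** for the structure on `(Y_T)_G` INDUCED by the monoidal base-change functor along `ℓ`
from the descended structure on `Y_T` (`Functor.monObjObj`, kept apart from the transported structure used in the construction) and the given
structure on `Y_G`. [cite: EGAIV3, Thm. 8.8.2] -/
theorem GrpSpreadAlong.isMonHom_facObjIso_hom (d : GrpSpreadAlong ℓ Y) :
    letI : GrpObj ((Over.pullback T.hom).obj Y) := d.grpObj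
    @IsMonHom _ _ _ _ _ (Functor.monObjObj (F := Over.pullback ℓ.left) ((Over.pullback T.hom).obj Y)) inferInstance
      (facObjIso ℓ Y).hom :=
  LiftedGrpData.isMonHom_hom (facObjIso ℓ Y) d.liftedGrpData

/-- Transport of commutativity along `MonObj.ofIso`. [cite: GortzWedhorn2020, §(4.7) Prop. 4.16] -/
private theorem isCommMonObj_ofIso {C : Type*} [Category C] [MonoidalCategory C] [BraidedCategory C] {M N : C} [MonObj M]
    [IsCommMonObj M] (e : M ≅ N) : letI := MonObj.ofIso e; IsCommMonObj N := by
  letI := MonObj.ofIso e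
  refine { mul_comm := ?_ }
  rw [MonObj.ofIso_mul, ← Category.assoc, ← BraidedCategory.braiding_naturality, Category.assoc, IsCommMonObj.mul_comm_assoc]

/-- **The descended group law on `Y_T` is commutative when `Y_G` is.** [cite: EGAIV3, Thm. 8.8.2 (i)] -/
theorem GrpSpreadAlong.isCommMonObj (d : GrpSpreadAlong ℓ Y) [IsCommMonObj ((Over.pullback G.hom).obj Y)] :
    letI : GrpObj ((Over.pullback T.hom).obj Y) := d.grpObj
    IsCommMonObj ((Over.pullback T.hom).obj Y) := by
  haveI : IsCommMonObj ((Over.pullback ℓ.left).obj ((Over.pullback T.hom).obj Y)) := isCommMonObj_ofIso (facObjIso ℓ Y).symm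
  exact d.liftedGrpData.isCommMonObj_of

end Transfer

end OverFac

end Literature.AlgebraicGeometry.Limits

end
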